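import Literature.Computability.MetaComplexity.ResLinPerfectMatchingTreeLikeSpine
import HarnessLib

/-!
# The onto-functional pigeonhole principle has `O(n³)`-size tree-like Res(⊕) refutations (Itsykson–Sokolov 2014, Prop. 3.2 for `K_{n+1,n}`)

Part 3 of the reproduction of Itsykson–Sokolov's Prop. 3.2 (`ResLinPerfectMatchingTreeLike*.lean`):
the instance `G = K_{m,n}`.  The incidence structure `kmnEdges m n` on the `m + n` vertices of the
complete bipartite graph (pigeons `i < m`, holes `j < n`, edge variable `x_{i,j} = i·n + j` — the
numbering of `pigeonholeCNF`) makes `pmCNF (kmnEdges m n)` the ONTO-FUNCTIONAL pigeonhole principle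
`onto-FPHP^m_n` (pigeon clauses `⋁_j x_{ij}`, functionality `¬x_{ij} ∨ ¬x_{ij'}`, onto clauses
`⋁_i x_{ij}`, hole clauses `¬x_{ij} ∨ ¬x_{i'j}`; Mikša–Nordström 2015 (4.2a)–(4.2d)).  Every variable
lies in exactly two vertex sets (`card_filter_mem_kmnEdges`), so for `m + n` odd — in particular
`m = n + 1` — the general theorem gives:

**Theorem** (`exists_treeLike_isResLinRefutation_ontoFPHP`).  `onto-FPHP^{n+1}_n` has a tree-like
Res(⊕) refutation with at most `2 + (2n+1) · 3(n+2)²` lines.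

Contrast (both kernel-checked): every tree-like Res(⊕) refutation of `PHP^m_n` has `≥ 2^n` lines
(`two_pow_le_length_pigeonholeCNF_treeLike`, Gryaznov–Ovcharov–Riazanov 2024 Thm 3 / Itsykson–Sokolov
2014); adding the functionality AND onto axioms collapses the tree-like Res(⊕) complexity to a
polynomial (Itsykson–Sokolov 2014, abstract, p. 2: "PM(K_{n,n+1}) has polynomial size linear splitting
trees while PM(K_{n,n+1}) are exponentially hard for resolution"; Prop. 3.2, p. 4), whereas the functional principle
WITHOUT onto axioms stays hard even for polynomial calculus (Mikša–Nordström 2015, Thm 4.9 — typed as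
the named fact `MiksaNordstrom2015_PC_FPHP_degree`).

References: D. Itsykson, D. Sokolov, MFCS 2014, Prop. 3.2 [ItsyksonSokolov2020]; M. Mikša,
J. Nordström, CCC 2015, §1 and §4.2 [MiksaNordstrom2015].
-/

namespace Literature.Computability.MetaComplexity

open _root_.Computability Complexity Finset

/-! ### The complete bipartite incidence structure -/

/-- The incidence structure of `K_{m,n}` on `m + n` vertices: pigeon `i < m` owns the edge variables
`x_{i,j} = i·n + j` (`j < n`), hole `j` (vertex `m + j`) owns `x_{i,j}` (`i < m`).
[Itsykson–Sokolov 2014, §3 (PM(K_{n,n+1}))] [cite: ItsyksonSokolov2020, §3] -/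
def kmnEdges (m n : ℕ) (v : Fin (m + n)) : Finset ℕ :=
  if (v : ℕ) < m then (Finset.range n).image fun j => (v : ℕ) * n + j
  else (Finset.range m).image fun i => i * n + ((v : ℕ) - m)

variable {m n : ℕ}

/-- Decoding an edge variable: `i·n + j` with `j < n` determines `i` and `j`. [folklore] -/
private theorem decode {i j i' j' : ℕ} (hj : j < n) (hj' : j' < n) (h : i * n + j = i' * n + j') :
    i = i' ∧ j = j' := by
  have hn : 0 < n := by omega
  have h1 : (i * n + j) / n = i := by
    rw [show i * n + j = j + i * n by ring, Nat.add_mul_div_right _ _ hn, Nat.div_eq_of_lt hj,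
      zero_add]
  have h2 : (i' * n + j') / n = i' := by
    rw [show i' * n + j' = j' + i' * n by ring, Nat.add_mul_div_right _ _ hn, Nat.div_eq_of_lt hj',
      zero_add]
  rw [h] at h1
  have hi : i = i' := h1.symm.trans h2 |>.symm |>.symm
  subst hi
  exact ⟨rfl, by omega⟩

/-- Membership in a pigeon's edge set. [folklore] -/
theorem mem_kmnEdges_pigeon {v : Fin (m + n)} (hv : (v : ℕ) < m) {x : ℕ} :
    x ∈ kmnEdges m n v ↔ ∃ j < n, (v : ℕ) * n + j = x := by
  simp [kmnEdges, hv]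

/-- Membership in a hole's edge set. [folklore] -/
theorem mem_kmnEdges_hole {v : Fin (m + n)} (hv : ¬ (v : ℕ) < m) {x : ℕ} :
    x ∈ kmnEdges m n v ↔ ∃ i < m, i * n + ((v : ℕ) - m) = x := by
  simp [kmnEdges, hv]

/-- Every vertex owns at most `max m n` edge variables. [folklore] -/
theorem card_kmnEdges_le (v : Fin (m + n)) : (kmnEdges m n v).card ≤ max m n := by
  unfold kmnEdges
  split_ifs
  · exact Finset.card_image_le.trans (by rw [Finset.card_range]; exact le_max_right _ _)
  · exact Finset.card_image_le.trans (by rw [Finset.card_range]; exact le_max_left _ _)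

/-- **Every edge variable lies in exactly two vertex sets** (its pigeon and its hole). [folklore] -/
theorem card_filter_mem_kmnEdges (x : ℕ) (hx : x ∈ Finset.univ.biUnion (kmnEdges m n)) :
    (Finset.univ.filter fun v : Fin (m + n) => x ∈ kmnEdges m n v).card = 2 := by
  -- decode `x = i·n + j`
  obtain ⟨i, j, hi, hj, rfl⟩ : ∃ i j, i < m ∧ j < n ∧ x = i * n + j := by
    rw [Finset.mem_biUnion] at hx
    obtain ⟨v, -, hv⟩ := hx
    by_cases h : (v : ℕ) < m
    · obtain ⟨j, hj, rfl⟩ := (mem_kmnEdges_pigeon h).1 hv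
      exact ⟨v, j, h, hj, rfl⟩
    · obtain ⟨i, hi, rfl⟩ := (mem_kmnEdges_hole h).1 hv
      have := v.isLt
      exact ⟨i, (v : ℕ) - m, hi, by omega, rfl⟩
  have hP : (⟨i, by omega⟩ : Fin (m + n)) ≠ ⟨m + j, by omega⟩ := by
    intro h; have := congrArg Fin.val h; simp at this; omega
  rw [show (Finset.univ.filter fun v : Fin (m + n) => i * n + j ∈ kmnEdges m n v) =
      {⟨i, by omega⟩, ⟨m + j, by omega⟩} from ?_, Finset.card_pair hP]
  ext v
  simp only [Finset.mem_filter, Finset.mem_univ, true_and, Finset.mem_insert, Finset.mem_singleton]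
  constructor
  · intro hv
    by_cases h : (v : ℕ) < m
    · obtain ⟨j', hj', he⟩ := (mem_kmnEdges_pigeon h).1 hv
      obtain ⟨h1, -⟩ := decode hj' hj he
      exact Or.inl (Fin.ext h1)
    · obtain ⟨i', hi', he⟩ := (mem_kmnEdges_hole h).1 hv
      have hvlt := v.isLt
      obtain ⟨-, h2⟩ := decode (by omega) hj he
      exact Or.inr (Fin.ext (by simp; omega))
  · rintro (rfl | rfl)
    · exact (mem_kmnEdges_pigeon (by exact hi)).2 ⟨j, hj, rfl⟩
    · exact (mem_kmnEdges_hole (by simp)).2 ⟨i, hi, by simp⟩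

/-- **`PM(K_{m,n})` with `m + n` odd has polynomial-size tree-like Res(⊕) refutations**: at most
`2 + (m+n) · 3(max m n + 1)²` lines. [Itsykson–Sokolov 2014, Prop. 3.2] [cite: ItsyksonSokolov2020, §3] -/
theorem exists_treeLike_isResLinRefutation_pmCNF_kmn (hodd : Odd (m + n)) :
    ∃ π : List ResLinLine, IsResLinRefutation (pmCNF (kmnEdges m n)) π ∧
      (∀ i : ℕ, (π.map fun l => l.premises.count i).sum ≤ 1) ∧
      π.length ≤ 2 + (m + n) * (3 * (max m n + 1) ^ 2) :=
  exists_treeLike_isResLinRefutation_pmCNF hodd (fun x hx => card_filter_mem_kmnEdges x hx)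
    card_kmnEdges_le

/-- **The onto-functional pigeonhole principle `onto-FPHP^{n+1}_n = PM(K_{n+1,n})` has tree-like
Res(⊕) refutations with at most `2 + (2n+1)·3(n+2)²` lines** — polynomial, against `≥ 2^n` for
`PHP^m_n` (`two_pow_le_length_pigeonholeCNF_treeLike`). [Itsykson–Sokolov 2014, Prop. 3.2 ("the
formulas PM(K_{n,n+1}) … has polynomial size linear splitting trees")] [cite: ItsyksonSokolov2020, §3] -/
theorem exists_treeLike_isResLinRefutation_ontoFPHP (n : ℕ) :
    ∃ π : List ResLinLine, IsResLinRefutation (pmCNF (kmnEdges (n + 1) n)) π ∧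
      (∀ i : ℕ, (π.map fun l => l.premises.count i).sum ≤ 1) ∧
      π.length ≤ 2 + (2 * n + 1) * (3 * (n + 2) ^ 2) := by
  obtain ⟨π, hπ, htree, hlen⟩ := exists_treeLike_isResLinRefutation_pmCNF_kmn (m := n + 1) (n := n)
    ⟨n, by ring⟩
  refine ⟨π, hπ, htree, hlen.trans (le_of_eq ?_)⟩
  rw [show max (n + 1) n = n + 1 from max_eq_left (Nat.le_succ n)]
  ring

end Literature.Computability.MetaComplexity
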